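import Summits.Ventures.Crystal3D.Theses.StickyWulffConstant
import Summits.Ventures.Crystal3D.Theorems.StickyWulffConstantStackingLiminfUniformBoundArith
import Summits.Ventures.Crystal3D.Theorems.StickyWulffConstantStackingLiminfSupportedExcess
import Summits.Ventures.Crystal3D.Theorems.StickyWulffConstantStackingLiminfRefinedFibre
import Summits.Ventures.Crystal3D.Theorems.StickyWulffConstantStackingLiminfRefinedOffsets
import Literature.MathematicalPhysics.StatisticalMechanics.BarlowCoordination
import Literature.Geometry.DiscreteGeometry.TriangularLatticeContactBound
import HarnessLib

/-!
# The layer profile of a cluster in a Barlow stacking (refined word-uniform surface rung toward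
# `StackingLiminf`, stmt-Ventures-19145)

Cell `crystal3d-full`, venture `Summits/Ventures/Crystal3D`.  For an injective `N`-configuration
`x` on `barlowStacking 1 √(2/3) σ` (`σ` a Hägg word) write `n(κ)` for the number of balls in layer
`κ`, `d(κ) := 3n(κ) − (in-layer contacts of layer κ)` and
`b(κ) := (3/2)(n(κ) + n(κ+1)) − (contacts between layers κ and κ+1)`, so that
`6N − numContacts x = ∑ d + ∑ b`.  **Theorem `layerProfile`** packages the word-INDEPENDENT
facts: `d(κ)² + 3 ≥ 12 n(κ)`, `d ≥ 0` (on-lattice Harborth, `HarborthSpiral.twelve_mul_card_le`);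
`b(κ) ≥ (3/2)|n(κ) − n(κ+1)|` (a ball touches at most three balls of an adjacent layer); and NEW
`b(κ) ≥ (1/2)|n(κ) − n(κ+1)| + √max(n(κ), n(κ+1))` — a ball touches THREE balls of the adjacent
layer only if its label triangle lies in that layer's label set, and a label set `S` contains at
most `|S| − √|S|` such triangles (`card_supported_le_sub_sqrt`).  The word only decides WHICH
triangle orientation is used at each interface; both obey the same count.  Assembly into a
surface bound: `StickyWulffConstantStackingLiminfRefinedBound.lean`.

WHAT THIS IS NOT: any statement about which stacking is optimal; rung F-C1 not moved.
-/

noncomputable section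

namespace Summit.Ventures.Crystal3D.Theorems

open Finset
open Literature.MathematicalPhysics.StatisticalMechanics (barlowPos barlowStacking IsHaggSeq
  sixOffsets threeOffsets card_threeOffsets dist_barlowPos_eq_iff)
open Literature.Geometry.DiscreteGeometry.HarborthSpiral (Adj adjCount
  twelve_mul_card_le adjCount_eq_two_mul)

-- one long bookkeeping proof (coordinates, three kinds of contact pairs, two fibre counts per
-- interface): the default heartbeat budget is too small for the single declaration
set_option maxHeartbeats 2000000 in
/-- **Layer profile of a cluster in a Barlow stacking** (see the module docstring): layer sizes
`n`, in-layer deficiencies `d` and interface deficiencies `b` with the Harborth bound per layer, the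
terrace bound and the supported-triangle bound per interface, and
`numContacts + ∑ d + ∑ b ≤ 6N`. -/
theorem layerProfile (σ : ℤ → ℤ) (hσ : IsHaggSeq σ) {N : ℕ} (x : Fin N → EuclideanSpace ℝ (Fin 3))
    (hx : Function.Injective x) (hmem : ∀ i, x i ∈ barlowStacking 1 (Real.sqrt (2 / 3)) σ)
    (hN : 0 < N) :
    ∃ (kmin kmax : ℤ) (n : ℤ → ℕ) (d b : ℤ → ℝ), kmin ≤ kmax ∧
      (∀ κ, n κ ≠ 0 → kmin ≤ κ ∧ κ ≤ kmax) ∧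
      (∑ κ ∈ Finset.Icc kmin kmax, n κ = N) ∧
      (∀ κ, n κ = 0 → d κ = 0) ∧
      (∀ κ, 0 ≤ d κ ∧ 12 * (n κ : ℝ) ≤ d κ ^ 2 + 3) ∧
      (∀ κ, 3 / 2 * |(n κ : ℝ) - n (κ + 1)| ≤ b κ) ∧
      (∀ κ, 1 / 2 * |(n κ : ℝ) - n (κ + 1)| + Real.sqrt (max (n κ : ℝ) (n (κ + 1))) ≤ b κ) ∧
      (numContacts x : ℝ) + ∑ κ ∈ Finset.Icc kmin kmax, d κ +
        ∑ κ ∈ Finset.Icc (kmin - 1) kmax, b κ ≤ 6 * N := by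
  classical
  have hh : (Real.sqrt (2 / 3)) ^ 2 = 2 / 3 * (1 : ℝ) ^ 2 := by
    rw [Real.sq_sqrt (by norm_num)]; ring
  -- coordinates
  have hcoord : ∀ i, ∃ k a b : ℤ, x i = barlowPos 1 (Real.sqrt (2 / 3)) σ k a b := fun i => hmem i
  choose k a b hc using hcoord
  have hcoord_inj : ∀ i j, k i = k j → a i = a j → b i = b j → i = j := by
    intro i j h1 h2 h3; apply hx; rw [hc i, hc j, h1, h2, h3]
  have hshell : ∀ i j, dist (x i) (x j) = 1 →
      (k j = k i ∧ (a i - a j, b i - b j) ∈ sixOffsets) ∨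
      (k j = k i + 1 ∧ (a i - a j, b i - b j) ∈ threeOffsets (-σ (k i))) ∨
      (k j = k i - 1 ∧ (a i - a j, b i - b j) ∈ threeOffsets (σ (k i - 1))) := by
    intro i j hd; rw [hc i, hc j] at hd
    exact (dist_barlowPos_eq_iff hσ one_pos hh _ _ _ _ _ _).1 hd
  -- layers, their range, labels
  set K : Finset ℤ := univ.image k with hK
  have hKne : K.Nonempty := ⟨k ⟨0, hN⟩, mem_image_of_mem _ (mem_univ _)⟩
  set kmin := K.min' hKne with hkmin
  set kmax := K.max' hKne with hkmax
  have hkb : ∀ i, kmin ≤ k i ∧ k i ≤ kmax := fun i =>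
    ⟨K.min'_le _ (mem_image_of_mem _ (mem_univ _)), K.le_max' _ (mem_image_of_mem _ (mem_univ _))⟩
  set lab : Fin N → ℤ × ℤ := fun i => (a i, b i) with hlab
  set L : ℤ → Finset (Fin N) := fun κ => univ.filter fun i : Fin N => k i = κ with hL
  set n : ℤ → ℕ := fun κ => (L κ).card with hn
  set S : ℤ → Finset (ℤ × ℤ) := fun κ => (L κ).image lab with hS
  have hmemL : ∀ κ i, i ∈ L κ ↔ k i = κ := by
    intro κ i; simp only [hL, mem_filter, mem_univ, true_and]
  have hLinj : ∀ κ, Set.InjOn lab ↑(L κ) := by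
    intro κ i hi j hj heq
    simp only [hlab, Prod.mk.injEq] at heq
    exact hcoord_inj i j (((hmemL κ i).1 (mem_coe.1 hi)).trans
      ((hmemL κ j).1 (mem_coe.1 hj)).symm) heq.1 heq.2
  have hScard : ∀ κ, (S κ).card = n κ := fun κ => card_image_of_injOn (hLinj κ)
  have hmemS : ∀ κ (p : ℤ × ℤ), p ∈ S κ ↔ ∃ i, k i = κ ∧ lab i = p := by
    intro κ p; simp only [hS, hL, mem_image, mem_filter, mem_univ, true_and]
  have hlab_inj : ∀ i j, k i = k j → lab i = lab j → i = j := by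
    intro i j hk hl; simp only [hlab, Prod.mk.injEq] at hl
    exact hcoord_inj i j hk hl.1 hl.2
  -- ordered touching pairs, split by relative layer
  set P : Finset (Fin N × Fin N) :=
    univ.filter fun p => p.1 ≠ p.2 ∧ dist (x p.1) (x p.2) = 1 with hP
  have hPcard : P.card = 2 * numContacts x := by
    rw [← sum_coordination_eq, hP, card_filter, Fintype.sum_prod_type]
    refine sum_congr rfl fun i _ => ?_
    rw [coordination, contactNeighbors, card_filter]
    refine sum_congr rfl fun j _ => ?_
    by_cases hij : j = i
    · subst hij; simp
    · simp [hij, Ne.symm hij]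
  set Pin := P.filter fun p => k p.2 = k p.1 with hPin
  set Pup := P.filter fun p => k p.2 = k p.1 + 1 with hPup
  set Pdn := P.filter fun p => k p.2 = k p.1 - 1 with hPdn
  have hsplit : P.card ≤ Pin.card + Pup.card + Pdn.card := by
    have hsub : P ⊆ Pin ∪ Pup ∪ Pdn := by
      intro p hp
      have hd : dist (x p.1) (x p.2) = 1 := (mem_filter.1 hp).2.2
      rcases hshell p.1 p.2 hd with ⟨h, -⟩ | ⟨h, -⟩ | ⟨h, -⟩
      · exact mem_union_left _ (mem_union_left _ (mem_filter.2 ⟨hp, h⟩))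
      · exact mem_union_left _ (mem_union_right _ (mem_filter.2 ⟨hp, h⟩))
      · exact mem_union_right _ (mem_filter.2 ⟨hp, h⟩)
    calc P.card ≤ (Pin ∪ Pup ∪ Pdn).card := card_le_card hsub
      _ ≤ (Pin ∪ Pup).card + Pdn.card := card_union_le _ _
      _ ≤ Pin.card + Pup.card + Pdn.card := by gcongr; exact card_union_le _ _
  have hswap : Pdn.card = Pup.card := by
    refine card_nbij' Prod.swap Prod.swap (fun p hp => ?_) (fun p hp => ?_)
      (fun p _ => Prod.swap_swap p) (fun p _ => Prod.swap_swap p)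
    · obtain ⟨hpP, hk⟩ := mem_filter.1 (mem_coe.1 hp)
      obtain ⟨-, hne, hd⟩ := mem_filter.1 hpP
      refine mem_coe.2 (mem_filter.2 ⟨mem_filter.2 ⟨mem_univ _, ?_, ?_⟩, ?_⟩)
      · exact fun h => hne h.symm
      · rw [Prod.fst_swap, Prod.snd_swap, dist_comm]; exact hd
      · rw [Prod.fst_swap, Prod.snd_swap]; omega
    · obtain ⟨hpP, hk⟩ := mem_filter.1 (mem_coe.1 hp)
      obtain ⟨-, hne, hd⟩ := mem_filter.1 hpP
      refine mem_coe.2 (mem_filter.2 ⟨mem_filter.2 ⟨mem_univ _, ?_, ?_⟩, ?_⟩)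
      · exact fun h => hne h.symm
      · rw [Prod.fst_swap, Prod.snd_swap, dist_comm]; exact hd
      · rw [Prod.fst_swap, Prod.snd_swap]; omega
  set pin : ℤ → ℕ := fun κ => (Pin.filter fun p => k p.1 = κ).card with hpin
  set up : ℤ → ℕ := fun κ => (Pup.filter fun p => k p.1 = κ).card with hup
  set d : ℤ → ℝ := fun κ => 3 * (n κ : ℝ) - (pin κ : ℝ) / 2 with hd
  set bb : ℤ → ℝ := fun κ => 3 / 2 * ((n κ : ℝ) + n (κ + 1)) - (up κ : ℝ) with hbb
  -- in-layer pairs of layer `κ` inject into adjacent label pairs of `S κ`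
  have hpin_le : ∀ κ, pin κ ≤ adjCount (S κ) := by
    intro κ
    have hfib : pin κ = ∑ i ∈ L κ, ((Pin.filter fun p => k p.1 = κ).filter fun p => p.1 = i).card :=
      card_eq_sum_card_fiberwise (f := Prod.fst) (s := Pin.filter fun p => k p.1 = κ) (t := L κ)
        fun p hp => (hmemL κ _).2 (mem_filter.1 hp).2
    have hle : ∀ i ∈ L κ, ((Pin.filter fun p => k p.1 = κ).filter fun p => p.1 = i).card ≤
        ((S κ).filter (Adj (a i, b i))).card := by
      intro i hi
      have hki : k i = κ := (hmemL κ i).1 hi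
      refine card_le_card_of_injOn (fun p => (a p.2, b p.2)) (fun p hp => ?_) ?_
      · obtain ⟨hp1, hpi⟩ := mem_filter.1 hp
        obtain ⟨hp2, hpκ⟩ := mem_filter.1 hp1
        obtain ⟨hpP, hkk⟩ := mem_filter.1 hp2
        have hd := (mem_filter.1 hpP).2.2
        rw [mem_coe, mem_filter]
        refine ⟨(hmemS κ _).2 ⟨p.2, by omega, rfl⟩, ?_⟩
        rw [hpi] at hd
        rcases hshell i p.2 hd with ⟨-, h6⟩ | ⟨h, -⟩ | ⟨h, -⟩
        · exact (mem_sixOffsets_iff_adj _ _ _ _).1 h6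
        · omega
        · omega
      · intro p hp q hq heq
        simp only [Prod.mk.injEq] at heq
        obtain ⟨hp1, hpi⟩ := mem_filter.1 (mem_coe.1 hp)
        obtain ⟨hq1, hqi⟩ := mem_filter.1 (mem_coe.1 hq)
        obtain ⟨hp2, hpκ⟩ := mem_filter.1 hp1
        obtain ⟨hq2, hqκ⟩ := mem_filter.1 hq1
        have hkp := (mem_filter.1 hp2).2
        have hkq := (mem_filter.1 hq2).2
        have h2 : p.2 = q.2 := hcoord_inj p.2 q.2 (by omega) heq.1 heq.2
        exact Prod.ext (hpi.trans hqi.symm) h2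
    have hreindex : ∑ i ∈ L κ, ((S κ).filter (Adj (a i, b i))).card = adjCount (S κ) := by
      rw [adjCount_eq_sum]
      have hSκ : S κ = (L κ).image lab := rfl
      rw [hSκ]
      exact (sum_image (f := fun q => (((L κ).image lab).filter (Adj q)).card)
        fun i hi j hj h => hLinj κ (mem_coe.2 hi) (mem_coe.2 hj) h).symm
    rw [hfib, ← hreindex]; exact sum_le_sum hle
  -- cross-layer pairs: terrace and supported-triangle bounds at each interface
  have hO3 : ∀ τ, (threeOffsets τ).card = 3 := card_threeOffsets
  have hup_bounds : ∀ κ, ((up κ : ℝ) ≤ 3 * n (κ + 1) ∧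
      (up κ : ℝ) ≤ 2 * n (κ + 1) + ((n κ : ℝ) - Real.sqrt (n κ))) ∧
      ((up κ : ℝ) ≤ 3 * n κ ∧
        (up κ : ℝ) ≤ 2 * n κ + ((n (κ + 1) : ℝ) - Real.sqrt (n (κ + 1)))) := by
    intro κ
    have hσκ : σ κ = 1 ∨ σ κ = -1 := hσ κ
    have hnegσ : -σ κ = 1 ∨ -σ κ = -1 := by omega
    set Q := Pup.filter fun p => k p.1 = κ with hQ
    have hQmem : ∀ p ∈ Q, k p.1 = κ ∧ k p.2 = κ + 1 ∧
        (a p.1 - a p.2, b p.1 - b p.2) ∈ threeOffsets (-σ κ) := by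
      intro p hp
      obtain ⟨hpU, hk1⟩ := mem_filter.1 hp
      obtain ⟨hpP, hk2⟩ := mem_filter.1 hpU
      refine ⟨hk1, by omega, ?_⟩
      have hd := (mem_filter.1 hpP).2.2
      rcases hshell p.1 p.2 hd with ⟨h, -⟩ | ⟨-, h⟩ | ⟨h, -⟩
      · omega
      · rw [hk1] at h; exact h
      · omega
    constructor
    · -- base = the upper ball, partners in layer `κ` at offsets `threeOffsets (-σ κ)`
      set Q' := Q.image Prod.swap with hQ'
      have hQ'card : Q'.card = up κ := card_image_of_injective _ Prod.swap_injective
      have hQ'mem : ∀ p ∈ Q', k p.2 = κ ∧ k p.1 = κ + 1 ∧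
          (a p.2 - a p.1, b p.2 - b p.1) ∈ threeOffsets (-σ κ) := by
        intro p hp
        obtain ⟨q, hq, rfl⟩ := mem_image.1 hp
        simpa only [Prod.fst_swap, Prod.snd_swap] using hQmem q hq
      have h1 := card_le_sum_card_filter_offsets Q' lab (threeOffsets (-σ κ)) (S κ)
        (fun p hp => by simpa only [hlab, Prod.mk_sub_mk] using (hQ'mem p hp).2.2)
        (fun p hp => (hmemS κ _).2 ⟨p.2, (hQ'mem p hp).1, rfl⟩)
        (fun p hp p' hp' h1 h2 => Prod.ext h1
          (hlab_inj _ _ (((hQ'mem p hp).1).trans ((hQ'mem p' hp').1).symm) h2))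
      set B := Q'.image Prod.fst with hB
      have hBsub : B ⊆ L (κ + 1) := fun u hu => by
        obtain ⟨p, hp, rfl⟩ := mem_image.1 hu
        exact (hmemL _ _).2 (hQ'mem p hp).2.1
      have hBcard : B.card ≤ n (κ + 1) := card_le_card hBsub
      have h3 : ∑ u ∈ B, ((threeOffsets (-σ κ)).filter fun o => lab u + o ∈ S κ).card ≤
          3 * B.card := by
        rw [mul_comm]
        exact sum_le_card_nsmul _ _ _ fun u _ => (card_filter_le _ _).trans (hO3 _).le
      have h2 := sum_card_filter_le B (hO3 (-σ κ)) (fun u o => lab u + o ∈ S κ)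
      have hsupp : (B.filter fun u => ∀ o ∈ threeOffsets (-σ κ), lab u + o ∈ S κ).card ≤
          ((S κ).filter fun w => (w.1 + σ κ, w.2) ∈ S κ ∧ (w.1, w.2 + σ κ) ∈ S κ).card := by
        refine card_le_card_of_injOn lab (fun u hu => ?_) fun u hu u' hu' h => ?_
        · obtain ⟨huB, hall⟩ := mem_filter.1 (mem_coe.1 hu)
          rw [forall_mem_threeOffsets_iff hnegσ, neg_neg] at hall
          obtain ⟨h0, h1', h2'⟩ := hall
          rw [mem_coe, mem_filter]
          simp only [hlab, Prod.mk_add_mk, add_zero] at h0 h1' h2' ⊢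
          exact ⟨h0, h1', h2'⟩
        · exact hlab_inj u u' (((hmemL _ _).1 (hBsub (mem_filter.1 (mem_coe.1 hu)).1)).trans
            ((hmemL _ _).1 (hBsub (mem_filter.1 (mem_coe.1 hu')).1)).symm) h
      have hexc := card_supported_le_sub_sqrt (S κ) hσκ
      rw [hScard] at hexc
      constructor
      · have : up κ ≤ 3 * n (κ + 1) := by
          rw [← hQ'card]; exact h1.trans (h3.trans (Nat.mul_le_mul_left 3 hBcard))
        exact_mod_cast this
      · have hnat : up κ ≤ 2 * n (κ + 1) +
            ((S κ).filter fun w => (w.1 + σ κ, w.2) ∈ S κ ∧ (w.1, w.2 + σ κ) ∈ S κ).card := by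
          rw [← hQ'card]; exact h1.trans (h2.trans (by omega))
        have : (up κ : ℝ) ≤ 2 * n (κ + 1) +
            (((S κ).filter fun w => (w.1 + σ κ, w.2) ∈ S κ ∧ (w.1, w.2 + σ κ) ∈ S κ).card : ℝ) := by
          exact_mod_cast hnat
        linarith
    · -- base = the lower ball, partners in layer `κ + 1` at offsets `threeOffsets (σ κ)`
      have h1 := card_le_sum_card_filter_offsets Q lab (threeOffsets (σ κ)) (S (κ + 1))
        (fun p hp => by
          have h := (hQmem p hp).2.2
          rw [mem_threeOffsets_iff' hnegσ] at h
          simp only [hlab, Prod.mk_sub_mk, mem_threeOffsets_iff' hσκ]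
          omega)
        (fun p hp => (hmemS (κ + 1) _).2 ⟨p.2, (hQmem p hp).2.1, rfl⟩)
        (fun p hp p' hp' h1 h2 => Prod.ext h1
          (hlab_inj _ _ (((hQmem p hp).2.1).trans ((hQmem p' hp').2.1).symm) h2))
      set B := Q.image Prod.fst with hB
      have hBsub : B ⊆ L κ := fun u hu => by
        obtain ⟨p, hp, rfl⟩ := mem_image.1 hu
        exact (hmemL _ _).2 (hQmem p hp).1
      have hBcard : B.card ≤ n κ := card_le_card hBsub
      have h3 : ∑ u ∈ B, ((threeOffsets (σ κ)).filter fun o => lab u + o ∈ S (κ + 1)).card ≤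
          3 * B.card := by
        rw [mul_comm]
        exact sum_le_card_nsmul _ _ _ fun u _ => (card_filter_le _ _).trans (hO3 _).le
      have h2 := sum_card_filter_le B (hO3 (σ κ)) (fun u o => lab u + o ∈ S (κ + 1))
      have hsupp : (B.filter fun u => ∀ o ∈ threeOffsets (σ κ), lab u + o ∈ S (κ + 1)).card ≤
          ((S (κ + 1)).filter fun w => (w.1 + -σ κ, w.2) ∈ S (κ + 1) ∧
            (w.1, w.2 + -σ κ) ∈ S (κ + 1)).card := by
        refine card_le_card_of_injOn lab (fun u hu => ?_) fun u hu u' hu' h => ?_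
        · obtain ⟨huB, hall⟩ := mem_filter.1 (mem_coe.1 hu)
          rw [forall_mem_threeOffsets_iff hσκ] at hall
          obtain ⟨h0, h1', h2'⟩ := hall
          rw [mem_coe, mem_filter]
          simp only [hlab, Prod.mk_add_mk, add_zero] at h0 h1' h2' ⊢
          exact ⟨h0, h1', h2'⟩
        · exact hlab_inj u u' (((hmemL _ _).1 (hBsub (mem_filter.1 (mem_coe.1 hu)).1)).trans
            ((hmemL _ _).1 (hBsub (mem_filter.1 (mem_coe.1 hu')).1)).symm) h
      have hexc := card_supported_le_sub_sqrt (S (κ + 1)) hnegσ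
      rw [hScard] at hexc
      constructor
      · have : up κ ≤ 3 * n κ := h1.trans (h3.trans (Nat.mul_le_mul_left 3 hBcard))
        exact_mod_cast this
      · have hnat : up κ ≤ 2 * n κ +
            ((S (κ + 1)).filter fun w => (w.1 + -σ κ, w.2) ∈ S (κ + 1) ∧
              (w.1, w.2 + -σ κ) ∈ S (κ + 1)).card := h1.trans (h2.trans (by omega))
        have : (up κ : ℝ) ≤ 2 * n κ +
            (((S (κ + 1)).filter fun w => (w.1 + -σ κ, w.2) ∈ S (κ + 1) ∧
              (w.1, w.2 + -σ κ) ∈ S (κ + 1)).card : ℝ) := by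
          exact_mod_cast hnat
        linarith
  -- the facts
  refine ⟨kmin, kmax, n, d, bb, K.min'_le _ (K.max'_mem hKne), ?_, ?_, ?_, ?_, ?_, ?_, ?_⟩
  · -- support
    intro κ hκ
    obtain ⟨i, hi⟩ := card_pos.1 (Nat.pos_of_ne_zero hκ)
    exact ((hmemL κ i).1 hi) ▸ hkb i
  · -- total
    have := card_eq_sum_card_fiberwise (f := k) (s := (univ : Finset (Fin N)))
      (t := Finset.Icc kmin kmax) fun i _ => mem_Icc.2 (hkb i)
    rw [card_univ, Fintype.card_fin] at this
    exact this.symm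
  · -- empty layers
    intro κ hκ
    have hL0 : L κ = ∅ := card_eq_zero.1 hκ
    have hpin0 : pin κ = 0 := by
      refine card_eq_zero.2 (filter_eq_empty_iff.2 fun p hp hpk => ?_)
      have : p.1 ∈ L κ := (hmemL κ _).2 hpk
      rw [hL0] at this; exact absurd this (Finset.notMem_empty _)
    simp only [hd, hκ, hpin0, Nat.cast_zero]; ring
  · -- Harborth per layer
    intro κ
    by_cases hκ : n κ = 0
    · have hL0 : L κ = ∅ := card_eq_zero.1 hκ
      have hpin0 : pin κ = 0 := by
        refine card_eq_zero.2 (filter_eq_empty_iff.2 fun p hp hpk => ?_)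
        have : p.1 ∈ L κ := (hmemL κ _).2 hpk
        rw [hL0] at this; exact absurd this (Finset.notMem_empty _)
      simp only [hd, hκ, hpin0, Nat.cast_zero]; norm_num
    · have hne : (S κ).Nonempty := by
        rw [← card_pos, hScard]; exact Nat.pos_of_ne_zero hκ
      obtain ⟨h12, hlt⟩ := twelve_mul_card_le (S κ) hne
      have h2e := adjCount_eq_two_mul (S κ)
      set e := Literature.Geometry.DiscreteGeometry.HarborthSpiral.horizBonds (S κ) +
        Literature.Geometry.DiscreteGeometry.HarborthSpiral.vertBonds (S κ) +
        Literature.Geometry.DiscreteGeometry.HarborthSpiral.diagBonds (S κ) with he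
      rw [hScard κ] at h12 hlt
      have hpe : (pin κ : ℝ) ≤ 2 * (e : ℝ) := by
        have := hpin_le κ; rw [h2e] at this; exact_mod_cast this
      have h12r : 12 * (n κ : ℝ) ≤ (3 * (n κ : ℝ) - e) ^ 2 + 3 := by exact_mod_cast h12
      have hltr : (e : ℝ) < 3 * (n κ : ℝ) := by exact_mod_cast hlt
      have hd0 : 0 ≤ 3 * (n κ : ℝ) - e := by linarith
      have hdge : 3 * (n κ : ℝ) - e ≤ d κ := by simp only [hd]; linarith
      refine ⟨hd0.trans hdge, ?_⟩
      nlinarith [mul_le_mul hdge hdge hd0 (hd0.trans hdge)]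
  · -- terrace bound
    intro κ
    obtain ⟨⟨hu1, -⟩, ⟨hu2, -⟩⟩ := hup_bounds κ
    simp only [hbb]
    rcases le_total (n (κ + 1) : ℝ) (n κ) with hle | hle
    · rw [abs_of_nonneg (by linarith)]; linarith
    · rw [abs_of_nonpos (by linarith)]; linarith
  · -- supported-triangle bound
    intro κ
    obtain ⟨⟨-, hu1⟩, ⟨-, hu2⟩⟩ := hup_bounds κ
    simp only [hbb]
    rcases le_total (n (κ + 1) : ℝ) (n κ) with hle | hle
    · rw [abs_of_nonneg (by linarith), max_eq_left hle]; linarith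
    · rw [abs_of_nonpos (by linarith), max_eq_right hle]; linarith
  · -- the sum identity
    have hPin_sum : Pin.card = ∑ κ ∈ Finset.Icc kmin kmax, pin κ :=
      card_eq_sum_card_fiberwise (f := fun p => k p.1) (s := Pin) (t := Finset.Icc kmin kmax)
        fun p _ => mem_Icc.2 (hkb p.1)
    have hPup_sum : Pup.card = ∑ κ ∈ Finset.Icc (kmin - 1) kmax, up κ :=
      card_eq_sum_card_fiberwise (f := fun p => k p.1) (s := Pup)
        (t := Finset.Icc (kmin - 1) kmax) fun p _ =>
          mem_Icc.2 ⟨by linarith [(hkb p.1).1], (hkb p.1).2⟩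
    have hn_sum : ∑ κ ∈ Finset.Icc kmin kmax, n κ = N := by
      have := card_eq_sum_card_fiberwise (f := k) (s := (univ : Finset (Fin N)))
        (t := Finset.Icc kmin kmax) fun i _ => mem_Icc.2 (hkb i)
      rw [card_univ, Fintype.card_fin] at this
      exact this.symm
    have hn_sum' : ∑ κ ∈ Finset.Icc (kmin - 1) kmax, n κ = N := by
      have := card_eq_sum_card_fiberwise (f := k) (s := (univ : Finset (Fin N)))
        (t := Finset.Icc (kmin - 1) kmax) fun i _ =>
          mem_Icc.2 ⟨by linarith [(hkb i).1], (hkb i).2⟩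
      rw [card_univ, Fintype.card_fin] at this
      exact this.symm
    have hn_succ : ∑ κ ∈ Finset.Icc (kmin - 1) kmax, n (κ + 1) = N := by
      have e1 : ∀ κ, n (κ + 1) = (univ.filter fun i : Fin N => k i - 1 = κ).card := by
        intro κ
        simp only [hn, hL]
        congr 1; ext i; simp only [mem_filter, mem_univ, true_and]; omega
      simp only [e1]
      have := card_eq_sum_card_fiberwise (f := fun i => k i - 1) (s := (univ : Finset (Fin N)))
        (t := Finset.Icc (kmin - 1) kmax) fun i _ =>
          mem_Icc.2 ⟨by linarith [(hkb i).1], by linarith [(hkb i).2]⟩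
      rw [card_univ, Fintype.card_fin] at this
      exact this.symm
    have hsd : ∑ κ ∈ Finset.Icc kmin kmax, d κ = 3 * (N : ℝ) - (Pin.card : ℝ) / 2 := by
      simp only [hd]
      rw [sum_sub_distrib, ← mul_sum, ← sum_div, ← Nat.cast_sum, ← Nat.cast_sum, hn_sum,
        hPin_sum]
    have hsb : ∑ κ ∈ Finset.Icc (kmin - 1) kmax, bb κ = 3 * (N : ℝ) - (Pup.card : ℝ) := by
      simp only [hbb]
      rw [sum_sub_distrib, ← mul_sum, sum_add_distrib, ← Nat.cast_sum, ← Nat.cast_sum,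
        ← Nat.cast_sum, hn_sum', hn_succ, hPup_sum]
      ring
    have h1 : 2 * numContacts x ≤ Pin.card + 2 * Pup.card := by rw [← hPcard]; omega
    have hcnt : (2 * numContacts x : ℝ) ≤ (Pin.card : ℝ) + 2 * (Pup.card : ℝ) := by
      exact_mod_cast h1
    rw [hsd, hsb]; linarith

end Summit.Ventures.Crystal3D.Theorems

end
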